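/-
Copyright: the b2b-balaban T⁴-continuum CRUX team, row NE7b OWNER lineage `t4-ne7b-p1` (gen 125). Project licence.
-/
import Summits.QuantumFields.BalabanUV.T4Continuum.Spine.NE7b.SupZdPerturbedCovarianceBounded
import Summits.QuantumFields.BalabanUV.T4Continuum.Spine.NE7b.SupZdCovarianceOperator

/-!
# THE `H + K` COLUMN'S FLUCTUATION COVARIANCE IS A BOUNDED OPERATOR ON `ℓ^∞(ℤ^d)`: for a kernel `|K(p,q)| ≤ εe^{−γ|p−q|₁}`, ANY bounded
# right inverse `G_K ∈ L(ℓ^∞(ℤ^d))` of `H_V + K` ((213)∕(216)'s), ANY coarse kernel `N` and response kernels `h^K_{b″}` with (220)'s three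
# displays: `C_K = G_K − H^K_resp∘Q′∘G_K ∈ L(ℓ^∞(ℤ^d))` with `‖C_K‖ ≤ ‖G_K‖(1 + C_hK_ν)` — `Q′` the block means (`‖Q′‖ ≤ 1`, (212)), `H^K_resp m =
# Σ″m(b″)h^K_{b″}` ((212)'s block-scale kernel operator, `‖H^K_resp‖ ≤ C_hK_ν`) — whose values are (253)'s fluctuation parts: `Q′(C_Kf) = 0` and
# `(H_V + K)(C_Kf) = f − (Σ″(Q′G_Kf)(b″)N(·,b″))∘blk` for every `f ∈ ℓ^∞(ℤ^d)`; (212)'s `H + K` twin, for ANY objects (row NE7b, node U5c;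
# (212)∕(253) BY NAME; [folklore])

Cell `pub-balaban`, sub-cell `t4`, spine estimate NE7b (`T4WeightBudget.RelWeightBound`; the cell's OWN estimate — NOT PRINTED in
[Bałaban 1983–89], NOT PROVED).  Crux-route work under `Spine/NE7b/` by the row OWNER (`t4-ne7b-p1` gen 125, file (254)) under FREEZE
(0)'s crux-prover clause; NOTHING of Bałaban's is named as a Lean object, valued or asserted; no `T4Continuum/Support` leaf typed; no `def`,
no notation (`C_K` is exhibited as `G_K − Rop∘Qop∘G_K` with (212)'s operators; `G_K`, `N`, `h^K` are ANY data with the displayed properties —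
(216) `zd_perturbed_profile` and (220)∕(222)∕(246) supply them by name); zero `sorry`.  Imports (BY NAME): the OWNER's (253)
`…SupZdPerturbedCovarianceBounded` (`zd_perturbed_fluctuation_bounded`), (212) `…SupZdCovarianceOperator` (`blockMean_clm`, `blk_kernel_clm`;
through it `OneShotChartSupOperator.abs_apply_le_norm`), Mathlib's `ContinuousLinearMap.opNorm_comp_le`, `norm_sub_le`.

WHY (located).  The sup road's currency is `L(ℓ^∞)` ((157)∕(188)∕(212)∕(213)): the three next-scale objects must be bounded operators with
data-free norms so that the next step's estimates compose.  (253) gave the perturbed fluctuation part on every bounded source; packaging it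
as `G_K − H^K_resp∘Q′∘G_K` is (212)'s construction verbatim with `G ↦ G_K`, `h ↦ h^K`, and the two identities are (253) (ii)∕(iii) read at `u = G_Kf`
(bounded by `‖G_Kf‖`, solving the equation by hypothesis).

WHAT IS PROVED ([folklore]): §1 THE END **`zd_perturbed_covariance_clm`** (for ALL `n, a, V, K` of the class, ANY `G_K` with
`(H_V + K)(G_Kf) = f` on `ℓ^∞`, ANY `N, h^K` with (220)'s displays: `∃ Cop ∈ L(ℓ^∞(ℤ^d))`, `‖Cop‖ ≤ ‖G_K‖(1 + C_hK_ν)`, the display, `Q′(Cop f) = 0`,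
the equation); §2 toy.

HONEST (what this is NOT).  Operator packaging only; no symmetry ∕ positivity of `C_K` on `ℓ²` (needs (231)∕(233)); no torus; no new
estimate; scalar skeleton ((A3), NC-NE7b-α UNRULED); nothing of the covariant propagators of [B4]–[B6]; nothing of Bałaban's asserted.
BY-NAME EFFECT ON THE WALL: NONE.  NE7b NOT PRINTED ∕ NOT PROVED; spine PROVED 0∕9; rung (B)+1 — the programme's measures remain
FINITE-torus statements; NOT the mass gap, NOT Clay.  HONEST DEPENDENCY: continuum YM on T⁴ ⇐ BetaPertH ∧ nine spine estimates (0∕9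
proved); BetaPertH ⇐ (D1) ∧ (D4) ∧ CAP+tail; G-an2-4 gates asym, D1 and NE2∕3∕4.
-/

set_option autoImplicit false

noncomputable section

namespace Summit.QuantumFields.BalabanUV.T4Continuum.NE7b.SupZdPerturbedCovarianceOperator

open Real Filter Topology
open scoped ENNReal
open Literature.MathematicalPhysics.QuantumFieldTheory.Balaban1983to89
open B6QGQLower276 (X e blk B)
open SupZdPerturbedColumn (K_pos)
open SupZdCovarianceOperator (blockMean_clm blk_kernel_clm)
open SupZdPerturbedCovarianceBounded (zd_perturbed_fluctuation_bounded)
open OneShotChartSupOperator (abs_apply_le_norm)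

variable {d : ℕ}

/-! ## §1. THE END: the perturbed fluctuation covariance as a bounded operator on `ℓ^∞(ℤ^d)` -/

/-- **HEADLINE — `C_K ∈ L(ℓ^∞(ℤ^d))`**: for every mesh `n`, coupling `a`, potential `V`, kernel `|K(p,q)| ≤ εe^{−γ|p−q|₁}` (`ε ≥ 0`, `γ > 0`), ANY
`G_K ∈ L(ℓ^∞(ℤ^d))` with `(H_V + K)(G_Kf) = f` for all `f ∈ ℓ^∞`, ANY coarse kernel `|N(b,c)| ≤ C_Ne^{−ν_N|b−c|₁}` and response kernels `h^K_{b″}` with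
`|h^K_{b″}(p)| ≤ C_he^{−ν|blk n p − b″|₁}`, `Q′h^K_{b″} = δ_{·b″}`, `(H_V + K)h^K_{b″} = N(blk n ·, b″)`: there is `Cop ∈ L(ℓ^∞(ℤ^d))` with
`‖Cop‖ ≤ ‖G_K‖(1 + C_hK_ν)`, `Cop f = G_Kf − Σ″(Q′(G_Kf))(b″)h^K_{b″}`, `Q′(Cop f) = 0` and `(H_V + K)(Cop f) = f − (Σ″(Q′G_Kf)(b″)N(·,b″))∘blk` for every
`f ∈ ℓ^∞` — `Cop = G_K − H^K_resp∘Q′∘G_K` with (212)'s operators; the identities are (253) at `u = G_Kf`. [folklore] -/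
theorem zd_perturbed_covariance_clm (n : ℕ) (a : ℝ) {ε γ ν νN Ch CN : ℝ} (hε : 0 ≤ ε) (hγ : 0 < γ) (hν : 0 < ν) (hνN : 0 < νN)
    (V : X d → ℝ) (K : X d → X d → ℝ) (hK : ∀ p q, |K p q| ≤ ε * exp (-(γ * ∑ i, (((p i - q i).natAbs : ℕ) : ℝ))))
    (N : X d → X d → ℝ) (hN : ∀ b c, |N b c| ≤ CN * exp (-(νN * ∑ i, (((b i - c i).natAbs : ℕ) : ℝ))))
    (hr : X d → X d → ℝ) (hrd : ∀ b'' p, |hr b'' p| ≤ Ch * exp (-(ν * ∑ i, (((blk n p i - b'' i).natAbs : ℕ) : ℝ))))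
    (hrQ : ∀ b'' b, (((n : ℝ) + 1) ^ d)⁻¹ * ∑ q ∈ B n b, hr b'' q = if b = b'' then 1 else 0)
    (hrH : ∀ b'' p, ((n : ℝ) + 1) ^ 2 * ∑ μ', (2 * hr b'' p - hr b'' (p + e μ') - hr b'' (p - e μ'))
      + a / ((n : ℝ) + 1) ^ d * ∑ q ∈ B n (blk n p), hr b'' q + V p * hr b'' p + ∑' q : X d, K p q * hr b'' q
      = N (blk n p) b'')
    (GK : lp (fun _ : X d => ℝ) ∞ →L[ℝ] lp (fun _ : X d => ℝ) ∞)
    (hGK : ∀ (f : lp (fun _ : X d => ℝ) ∞) (p : X d),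
      ((n : ℝ) + 1) ^ 2 * ∑ μ', (2 * GK f p - GK f (p + e μ') - GK f (p - e μ'))
        + a / ((n : ℝ) + 1) ^ d * ∑ q ∈ B n (blk n p), GK f q + V p * GK f p + ∑' q : X d, K p q * GK f q = f p) :
    ∃ Cop : lp (fun _ : X d => ℝ) ∞ →L[ℝ] lp (fun _ : X d => ℝ) ∞,
      ‖Cop‖ ≤ ‖GK‖ * (1 + Ch * (2 * (1 - exp (-ν))⁻¹) ^ d) ∧
      (∀ (f : lp (fun _ : X d => ℝ) ∞) (p : X d), Cop f p
        = GK f p - ∑' b'' : X d, ((((n : ℝ) + 1) ^ d)⁻¹ * ∑ q ∈ B n b'', GK f q) * hr b'' p) ∧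
      (∀ (f : lp (fun _ : X d => ℝ) ∞) (b : X d), (((n : ℝ) + 1) ^ d)⁻¹ * ∑ q ∈ B n b, Cop f q = 0) ∧
      (∀ (f : lp (fun _ : X d => ℝ) ∞) (p : X d),
        ((n : ℝ) + 1) ^ 2 * ∑ μ', (2 * Cop f p - Cop f (p + e μ') - Cop f (p - e μ'))
          + a / ((n : ℝ) + 1) ^ d * ∑ q ∈ B n (blk n p), Cop f q + V p * Cop f p + ∑' q : X d, K p q * Cop f q
        = f p - ∑' b'' : X d, ((((n : ℝ) + 1) ^ d)⁻¹ * ∑ q ∈ B n b'', GK f q) * N (blk n p) b'') := by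
  classical
  have hCh : 0 ≤ Ch := by
    have h := (abs_nonneg _).trans (hrd 0 0)
    exact le_of_mul_le_mul_right (by rw [zero_mul]; exact h) (exp_pos _)
  have hKν : 0 < (2 * (1 - exp (-ν))⁻¹) ^ d := K_pos (d := d) hν
  obtain ⟨Qop, hQnorm, hQ⟩ := blockMean_clm (d := d) n
  obtain ⟨Rop, hRnorm, hR⟩ := blk_kernel_clm (d := d) n hCh hν (fun p b'' => hr b'' p) (fun p b'' => hrd b'' p)
  have hCf : ∀ (f : lp (fun _ : X d => ℝ) ∞) (q : X d), (GK - Rop.comp (Qop.comp GK)) f q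
      = GK f q - ∑' b'' : X d, ((((n : ℝ) + 1) ^ d)⁻¹ * ∑ q' ∈ B n b'', GK f q') * hr b'' q := by
    intro f q
    rw [show (GK - Rop.comp (Qop.comp GK)) f = GK f - Rop (Qop (GK f)) from rfl, lp.coeFn_sub, Pi.sub_apply, hR]
    exact congrArg _ (tsum_congr fun b'' => by rw [hQ])
  have H253 := fun f : lp (fun _ : X d => ℝ) ∞ =>
    zd_perturbed_fluctuation_bounded (d := d) n a hε hγ hν hνN V K hK N hN hr hrd hrQ hrH (fun q => f q) (fun q => GK f q)
      (fun q => abs_apply_le_norm (GK f) q) (hGK f)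
  refine ⟨GK - Rop.comp (Qop.comp GK), ?_, hCf, fun f b => ?_, fun f p => ?_⟩
  · -- the norm
    calc ‖GK - Rop.comp (Qop.comp GK)‖ ≤ ‖GK‖ + ‖Rop.comp (Qop.comp GK)‖ := norm_sub_le _ _
      _ ≤ ‖GK‖ + ‖Rop‖ * (‖Qop‖ * ‖GK‖) :=
          add_le_add le_rfl ((ContinuousLinearMap.opNorm_comp_le _ _).trans
            (mul_le_mul_of_nonneg_left (ContinuousLinearMap.opNorm_comp_le _ _) (norm_nonneg _)))
      _ ≤ ‖GK‖ + Ch * (2 * (1 - exp (-ν))⁻¹) ^ d * (1 * ‖GK‖) := by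
          gcongr
      _ = _ := by ring
  · -- zero block means ((253) (ii) with `u = G_Kf`)
    have h := (H253 f).2.2.2.2.1 b
    rw [← h]
    exact congrArg _ (Finset.sum_congr rfl fun q _ => hCf f q)
  · -- the equation ((253) (iii) with `u = G_Kf`)
    have h := (H253 f).2.2.2.2.2 p
    simp only [hCf]
    exact h

/-! ## §2. Toy -/

/-- Toy (`d = 2`, `n = 1`): (212)'s block-mean operator at mesh `1`, the `Q′` of this file, exists with norm `≤ 1`. -/
example : ∃ Qop : lp (fun _ : X 2 => ℝ) ∞ →L[ℝ] lp (fun _ : X 2 => ℝ) ∞,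
    ‖Qop‖ ≤ 1 ∧ ∀ (u : lp (fun _ : X 2 => ℝ) ∞) (b : X 2), Qop u b = ((((1 : ℕ) : ℝ) + 1) ^ 2)⁻¹ * ∑ q ∈ B 1 b, u q :=
  blockMean_clm (d := 2) 1

end Summit.QuantumFields.BalabanUV.T4Continuum.NE7b.SupZdPerturbedCovarianceOperator
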